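import Summits.KontsevichZagierPeriods.KontsevichZagierPeriods.Theses.CoactionDevissage
import Summits.KontsevichZagierPeriods.KontsevichZagierPeriods.Theorems.FurushoPentagonDualityInKZ

/-!
# `Duality` (stmt-KontsevichZagierPeriods-3171, route CoactionDevissage) — proof

Statement: with `ρ u := [KZ.mzvRep u]` for admissible `u` (and `0` otherwise), for every admissible index
`s` one has `ρ s − ρ (MZV.dual s) ∈ KZ.relations`: duality `ζ(s) = ζ(s†)` is a relation of the
Kontsevich–Zagier move calculus, not only an identity of real numbers (`multipleZeta_dual`).

Proof: `MZV.dual s` is admissible (`MZV.isAdmissible_dual`), so both `ρ`'s are genuine simplex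
representations (`dif_pos`), and the membership is literally
`KZ.Equivalent (mzvRep s) (mzvRep (dual s))`, the tree theorem
`Summit.KontsevichZagierPeriods.FurushoPentagon.DualityInKZ.DualityInKZ_proof`
(`Theorems/FurushoPentagonDualityInKZ.lean`, twin item stmt-3933 of route FurushoPentagon): ONE
change-of-variables move `tᵢ ↦ 1 − t_{w−1−i}` of the open ordered simplex (affine, linear part a signed
permutation matrix, `|det| = 1`, image the simplex itself by `KZ.mem_openOrderedSimplex_dual`, integrands
matched by `ω_{¬e}(1 − x) = ω_e(x)`, `KZ.mzvForm_not_one_sub`, and the word reversal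
`MZV.binaryWord_dual`), followed by the coordinate relabelling `Fin (weight s†) ≃ Fin (weight s)`
(`KZ.of_sub_of_reindex_mem_relations`), since the two weights agree only propositionally
(`MZV.weight_dual`). This file closes the item by that theorem (lead c10 of line `Sketch` of crux
`TateLifting`, banking calculus theorems where they close items). No new mathematics.

References: D. Zagier, *Values of zeta functions and their applications*, ECM 1992, Progr. Math. 120
(1994), §9; M. E. Hoffman, *Multiple harmonic series*, Pacific J. Math. 152 (1992), §3;
M. Kontsevich, D. Zagier, *Periods* (2001), §1.2 rule (2).
-/

namespace Summit.KontsevichZagierPeriods.CoactionDevissage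

open Literature.NumberTheory.Transcendental

/-- **`Duality`** (route CoactionDevissage, stmt-KontsevichZagierPeriods-3171): for every admissible
index `s`, `[mzvRep s] − [mzvRep (dual s)] ∈ KZ.relations` (with the route's `ρ`, both branches are the
genuine simplex representations since `dual s` is admissible). Proof: unfold `ρ` by `dif_pos` and apply
the one-move duality theorem `FurushoPentagon.DualityInKZ.DualityInKZ_proof` (change of variables
`tᵢ ↦ 1 − t_{w−1−i}`, `|det| = 1`, plus the reindexing `Fin (weight s†) ≃ Fin (weight s)`).
[Zagier 1994, §9; Kontsevich–Zagier 2001, §1.2 rule (2)] [folklore] -/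
theorem duality_proof :
    Summit.KontsevichZagierPeriods.KontsevichZagierPeriods.Theses.CoactionDevissage.Duality := by
  intro s hs
  simp only [dif_pos hs, dif_pos (MZV.isAdmissible_dual hs)]
  exact Summit.KontsevichZagierPeriods.FurushoPentagon.DualityInKZ.DualityInKZ_proof s hs

end Summit.KontsevichZagierPeriods.CoactionDevissage
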